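/-
Copyright: the b2b-balaban T⁴-continuum CRUX team, row NE7b OWNER lineage `t4-ne7b-p1` (gen 122). Project licence.
-/
import Summits.QuantumFields.BalabanUV.T4Continuum.Spine.NE7b.SupTorusActionForm
import Summits.QuantumFields.BalabanUV.T4Continuum.Spine.NE7b.FibreInverseMixedNorm

/-!
# THE WEIGHTED RESOLVENT LETTER SURVIVES EXPONENTIALLY SMALL NON-LOCAL PERTURBATIONS OF THE HESSIAN — the seed of ITERABILITY of the
# locality column: if `Hu + Ru = f` with `H = (n+1)²(−Δ) + a(n+1)^{−d}(block sums) + V` (displayed, `V ≥ −λ`) and ANY perturbation `R` whose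
# conjugated size is `‖e^{w}Re^{−w}‖_{2→2} ≤ r < m_w`, then `‖e^{w}u‖₂ ≤ (m_w − r)⁻¹‖e^{w}f‖₂` ((131) `weighted_resolvent_le` ⊛ Minkowski); for
# a KERNEL `R(x,z)` the conjugated size is at most the larger of the weighted row and column sums `Σ|R(x,z)|e^{w x − w z}` (Schur test), so
# kernels with `|R(x,z)| ≤ εe^{−γρ(x,z)}`, `γ` above the weight's rate, perturb the floor by `O(ε)`; at the zero weight `H + R` is injective.
# After one step the next action's Hessian `(n+1)^d T⁻¹` is such a kernel ((135)), not a nearest-neighbour form — this letter is what lets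
# (131)–(161) be re-run at the next scale (row NE7b, node U5c; (131)∕(133) BY NAME; [folklore])

Cell `pub-balaban`, sub-cell `t4`, spine estimate NE7b (`T4WeightBudget.RelWeightBound`; the cell's OWN estimate — NOT PRINTED in
[Bałaban 1983–89], NOT PROVED).  Crux-route work under `Spine/NE7b/` by the row OWNER (`t4-ne7b-p1` gen 122, file (162)) under FREEZE
(0)'s crux-prover clause; NOTHING of Bałaban's is named as a Lean object, valued or asserted; no `T4Continuum/Support` leaf typed; no `def`,
no notation (the action DISPLAYED; the perturbation enters as a function `Ru` with a displayed weighted bound, or as a displayed kernel sum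
`Σ_z R x z·u z`); zero `sorry`.  Imports (BY NAME): the OWNER's (133) `…SupTorusActionForm` (`action_sub`; through it (131)
`weighted_resolvent_le`), (53) `…FibreInverseMixedNorm` (`sqrt_sum_sq_sub_le`, Minkowski on a finite set).

WHY (located).  Every file (131)–(161) of the locality ∕ pointwise ∕ volume columns starts from (131)'s weighted resolvent letter for the
nearest-neighbour displayed action.  The road iterates: the next fine Hessian is `(n+1)^d T⁻¹` ((102)), a full matrix with exponentially
decaying entries ((135)), i.e. `nearest-neighbour part + R` with `R` exponentially small beyond a few blocks — not covered by (131) as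
stated.  The perturbation argument is one line on top of (131): `Hu = f − Ru`, so `‖e^{w}u‖ ≤ m⁻¹(‖e^{w}f‖ + ‖e^{w}Ru‖) ≤ m⁻¹(‖e^{w}f‖ +
r‖e^{w}u‖)`; and the Schur test bounds `‖e^{w}Re^{−w}‖_{2→2}` by the weighted row∕column sums — which for `|R(x,z)| ≤ εe^{−γρ(x,z)}` and
weights of rate `< γ` are `O(ε)` by (132)-type exponential sums (not repeated here).

WHAT IS PROVED ([folklore]; fine torus `Site d ((n+1)s)`; the action DISPLAYED; `m_w = min(2,a) − λ − 2d((n+1)τ)² − a(e^β − 1)` for a weight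
with bond letter `τ ≤ 1` and block letter `β` as in (131)):
* §1 **`schur_test_weighted`** (any finite carrier: `Σ_z|K x z|e^{w x − w z} ≤ r` for all `x` AND `Σ_x|K x z|e^{w x − w z} ≤ r` for all `z`, `r ≥ 0`
  ⟹ `√(Σ_x(e^{w x}Σ_z K x z·v z)²) ≤ r·√(Σ_z(e^{w z}v z)²)`).
* §2 **`perturbed_weighted_resolvent_le`** (`Hu + Ru = f` pointwise, `√(Σ(e^{w}Ru)²) ≤ r√(Σ(e^{w}u)²)`, `r < m_w` ⟹
  `√(Σ(e^{w}u)²) ≤ (m_w − r)⁻¹√(Σ(e^{w}f)²)`).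
* §3 **`perturbed_kernel_resolvent_le`** (the same for `Ru = Σ_z K(·,z)u z` under §1's two weighted sums), **`perturbed_injective`** (zero
  weight: `Σ_z|K x z| ≤ r`, `Σ_x|K x z| ≤ r`, `r < min(2,a) − λ` ⟹ `H + K` is injective).
* §4 toy.

HONEST (what this is NOT).  The resolvent letter only — the columns (132)–(161) are NOT re-derived for `H + R` here (that is the next
owner-sized job: every displayed-action hypothesis acquires a kernel term); no exponential-sum bookkeeping for specific kernels; constants as
displayed; cubic periods; scalar skeleton ((A3), NC-NE7b-α UNRULED); nothing of Bałaban's.  BY-NAME EFFECT ON THE WALL: NONE.  NE7b NOT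
PRINTED ∕ NOT PROVED; spine PROVED 0∕9; rung (B)+1 on a FINITE torus — NOT infinite volume, NOT the mass gap, NOT Clay.  HONEST DEPENDENCY:
continuum YM on T⁴ ⇐ BetaPertH ∧ nine spine estimates (0∕9 proved); BetaPertH ⇐ (D1) ∧ (D4) ∧ CAP+tail; G-an2-4 gates asym, D1 and NE2∕3∕4.
-/

set_option autoImplicit false

noncomputable section

namespace Summit.QuantumFields.BalabanUV.T4Continuum.NE7b.SupTorusPerturbedResolvent

open Real
open Literature.MathematicalPhysics.QuantumFieldTheory.Balaban1983to89
open B6QGQLower276 (X e blk B side chart mem_B sum_B sum_B_const card_cube)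
open Beta (Site siteOf windowMap siteOf_windowMap siteOf_add)
open SupTorusHessianCombesThomas (weighted_resolvent_le)
open SupTorusActionForm (action_sub)
open FibreInverseMixedNorm (sqrt_sum_sq_sub_le)

variable {d : ℕ}

/-! ## §1. The weighted Schur test -/

/-- **THE WEIGHTED SCHUR TEST** on a finite carrier: if the conjugated kernel `|K x z|e^{w x − w z}` has row sums AND column sums `≤ r`
(`r ≥ 0`), then `√(Σ_x (e^{w x}Σ_z K x z·v z)²) ≤ r·√(Σ_z (e^{w z}v z)²)` — Cauchy–Schwarz in `z` with the weights `|K|e^{w x − w z}`, then the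
column sums. [folklore] -/
theorem schur_test_weighted {ι : Type*} [Fintype ι] (K : ι → ι → ℝ) (w v : ι → ℝ) {r : ℝ} (hr : 0 ≤ r)
    (hrow : ∀ x, ∑ z, |K x z| * exp (w x - w z) ≤ r) (hcol : ∀ z, ∑ x, |K x z| * exp (w x - w z) ≤ r) :
    √(∑ x, (exp (w x) * ∑ z, K x z * v z) ^ 2) ≤ r * √(∑ z, (exp (w z) * v z) ^ 2) := by
  classical
  have hb : 0 ≤ ∑ z, (exp (w z) * v z) ^ 2 := Finset.sum_nonneg fun _ _ => sq_nonneg _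
  -- pointwise in `x`: `(e^{w x}Σ_z K v)² ≤ r·Σ_z |K x z|e^{w x − w z}(e^{w z}v z)²`
  have hpt : ∀ x, (exp (w x) * ∑ z, K x z * v z) ^ 2 ≤ r * ∑ z, |K x z| * exp (w x - w z) * (exp (w z) * v z) ^ 2 := by
    intro x
    have h1 : exp (w x) * ∑ z, K x z * v z = ∑ z, (K x z * exp (w x - w z)) * (exp (w z) * v z) := by
      rw [Finset.mul_sum]
      refine Finset.sum_congr rfl fun z _ => ?_
      rw [Real.exp_sub]
      field_simp
    have h2 : |∑ z, (K x z * exp (w x - w z)) * (exp (w z) * v z)|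
        ≤ ∑ z, √(|K x z| * exp (w x - w z)) * (√(|K x z| * exp (w x - w z)) * |exp (w z) * v z|) := by
      refine (Finset.abs_sum_le_sum_abs _ _).trans (le_of_eq (Finset.sum_congr rfl fun z _ => ?_))
      have hA : 0 ≤ |K x z| * exp (w x - w z) := by positivity
      calc |(K x z * exp (w x - w z)) * (exp (w z) * v z)| = |K x z| * exp (w x - w z) * |exp (w z) * v z| := by
            rw [abs_mul, abs_mul, abs_of_pos (exp_pos (w x - w z))]
        _ = √(|K x z| * exp (w x - w z)) * (√(|K x z| * exp (w x - w z)) * |exp (w z) * v z|) := by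
            rw [← mul_assoc, Real.mul_self_sqrt hA]
    have hCS := Finset.sum_mul_sq_le_sq_mul_sq Finset.univ (fun z => √(|K x z| * exp (w x - w z)))
      (fun z => √(|K x z| * exp (w x - w z)) * |exp (w z) * v z|)
    have h3 : ∑ z, √(|K x z| * exp (w x - w z)) ^ 2 = ∑ z, |K x z| * exp (w x - w z) :=
      Finset.sum_congr rfl fun z _ => Real.sq_sqrt (by positivity)
    have h4 : ∑ z, (√(|K x z| * exp (w x - w z)) * |exp (w z) * v z|) ^ 2 = ∑ z, |K x z| * exp (w x - w z) * (exp (w z) * v z) ^ 2 :=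
      Finset.sum_congr rfl fun z _ => by rw [mul_pow, Real.sq_sqrt (by positivity), sq_abs]
    rw [h3, h4] at hCS
    have h5 : 0 ≤ ∑ z, |K x z| * exp (w x - w z) * (exp (w z) * v z) ^ 2 := Finset.sum_nonneg fun _ _ => by positivity
    calc (exp (w x) * ∑ z, K x z * v z) ^ 2 = |∑ z, (K x z * exp (w x - w z)) * (exp (w z) * v z)| ^ 2 := by rw [h1, sq_abs]
      _ ≤ (∑ z, √(|K x z| * exp (w x - w z)) * (√(|K x z| * exp (w x - w z)) * |exp (w z) * v z|)) ^ 2 :=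
          pow_le_pow_left₀ (abs_nonneg _) h2 2
      _ ≤ (∑ z, |K x z| * exp (w x - w z)) * ∑ z, |K x z| * exp (w x - w z) * (exp (w z) * v z) ^ 2 := hCS
      _ ≤ r * ∑ z, |K x z| * exp (w x - w z) * (exp (w z) * v z) ^ 2 := mul_le_mul_of_nonneg_right (hrow x) h5
  -- sum over `x`, exchange, column sums
  have hsum : ∑ x, (exp (w x) * ∑ z, K x z * v z) ^ 2 ≤ r * (r * ∑ z, (exp (w z) * v z) ^ 2) := by
    calc ∑ x, (exp (w x) * ∑ z, K x z * v z) ^ 2 ≤ ∑ x, r * ∑ z, |K x z| * exp (w x - w z) * (exp (w z) * v z) ^ 2 :=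
          Finset.sum_le_sum fun x _ => hpt x
      _ = r * ∑ z, (∑ x, |K x z| * exp (w x - w z)) * (exp (w z) * v z) ^ 2 := by
          rw [← Finset.mul_sum, Finset.sum_comm]
          exact congrArg _ (Finset.sum_congr rfl fun z _ => (Finset.sum_mul _ _ _).symm)
      _ ≤ r * ∑ z : ι, r * (exp (w z) * v z) ^ 2 :=
          mul_le_mul_of_nonneg_left (Finset.sum_le_sum fun z _ => mul_le_mul_of_nonneg_right (hcol z) (sq_nonneg _)) hr
      _ = r * (r * ∑ z, (exp (w z) * v z) ^ 2) := by rw [← Finset.mul_sum]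
  calc √(∑ x, (exp (w x) * ∑ z, K x z * v z) ^ 2) ≤ √(r * (r * ∑ z, (exp (w z) * v z) ^ 2)) := Real.sqrt_le_sqrt hsum
    _ = r * √(∑ z, (exp (w z) * v z) ^ 2) := by
        rw [← mul_assoc, Real.sqrt_mul (mul_nonneg hr hr), Real.sqrt_mul_self hr]

/-! ## §2. The perturbed weighted resolvent letter -/

section Perturbed

variable (n : ℕ) (a : ℝ) (s : ℕ) [NeZero s] (ha : 0 ≤ a) (u w V f Ru : Site d ((n + 1) * s) → ℝ) {τ β lam r : ℝ} (hτ : τ ≤ 1)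
  (hwb : ∀ x μ, |w (x + siteOf d ((n + 1) * s) (e μ)) - w x| ≤ τ)
  (hwB : ∀ (y : Site d s) (z z' : Fin d → Fin (n + 1)),
    |w (siteOf d ((n + 1) * s) (chart n (windowMap d s y) z)) - w (siteOf d ((n + 1) * s) (chart n (windowMap d s y) z'))| ≤ β)
  (hV : ∀ x, -lam ≤ V x) (hr : 0 ≤ r)
  (hm : r < min 2 a - lam - 2 * d * (((n : ℝ) + 1) * τ) ^ 2 - a * (exp β - 1))
  (hR : √(∑ x, (exp (w x) * Ru x) ^ 2) ≤ r * √(∑ x, (exp (w x) * u x) ^ 2))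
  (hu : ∀ x, ((n : ℝ) + 1) ^ 2 * ∑ μ, (2 * u x - u (x + siteOf d ((n + 1) * s) (e μ)) - u (x - siteOf d ((n + 1) * s) (e μ)))
      + a / ((n : ℝ) + 1) ^ d * ∑ q ∈ B n (blk n (windowMap d ((n + 1) * s) x)), u (siteOf d ((n + 1) * s) q)
      + V x * u x + Ru x = f x)

include ha hτ hwb hwB hV hr hm hR hu in
/-- **THE PERTURBED WEIGHTED RESOLVENT LETTER**: `Hu + Ru = f` (displayed action plus any term `Ru` with `‖e^{w}Ru‖₂ ≤ r‖e^{w}u‖₂`), `r < m_w` ⟹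
`‖e^{w}u‖₂ ≤ (m_w − r)⁻¹‖e^{w}f‖₂` — (131) on the source `f − Ru` and Minkowski. [folklore] -/
theorem perturbed_weighted_resolvent_le :
    √(∑ x, (exp (w x) * u x) ^ 2)
      ≤ (min 2 a - lam - 2 * d * (((n : ℝ) + 1) * τ) ^ 2 - a * (exp β - 1) - r)⁻¹ * √(∑ x, (exp (w x) * f x) ^ 2) := by
  set m := min 2 a - lam - 2 * d * (((n : ℝ) + 1) * τ) ^ 2 - a * (exp β - 1) with hm_def
  have hm0 : 0 < m := lt_of_le_of_lt hr hm
  have hu' : ∀ x, ((n : ℝ) + 1) ^ 2 * ∑ μ, (2 * u x - u (x + siteOf d ((n + 1) * s) (e μ)) - u (x - siteOf d ((n + 1) * s) (e μ)))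
      + a / ((n : ℝ) + 1) ^ d * ∑ q ∈ B n (blk n (windowMap d ((n + 1) * s) x)), u (siteOf d ((n + 1) * s) q)
      + V x * u x = (fun x => f x - Ru x) x := fun x => by simp only; linarith [hu x]
  have h131 := weighted_resolvent_le n a s ha u w V (fun x => f x - Ru x) hτ hwb hwB hV hm0 hu'
  have hmink : √(∑ x, (exp (w x) * (f x - Ru x)) ^ 2) ≤ √(∑ x, (exp (w x) * f x) ^ 2) + √(∑ x, (exp (w x) * Ru x) ^ 2) := by
    have e1 : ∑ x, (exp (w x) * (f x - Ru x)) ^ 2 = ∑ x, (exp (w x) * f x - exp (w x) * Ru x) ^ 2 :=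
      Finset.sum_congr rfl fun x _ => by ring
    rw [e1]; exact sqrt_sum_sq_sub_le Finset.univ _ _
  set U := √(∑ x, (exp (w x) * u x) ^ 2) with hU
  set F := √(∑ x, (exp (w x) * f x) ^ 2) with hF
  have hU0 : 0 ≤ U := Real.sqrt_nonneg _
  have hF0 : 0 ≤ F := Real.sqrt_nonneg _
  have hkey : U ≤ m⁻¹ * (F + r * U) :=
    h131.trans (mul_le_mul_of_nonneg_left (hmink.trans (add_le_add le_rfl hR)) (inv_nonneg.2 hm0.le))
  -- `mU ≤ F + rU` ⟹ `(m − r)U ≤ F`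
  have hk2 : m * U ≤ F + r * U := by
    have := mul_le_mul_of_nonneg_left hkey hm0.le
    rwa [← mul_assoc, mul_inv_cancel₀ hm0.ne', one_mul] at this
  have hmr : 0 < m - r := by linarith
  rw [le_inv_mul_iff₀ hmr]
  linarith

end Perturbed

/-! ## §3. Kernel perturbations; injectivity at the zero weight -/

section Kernel

variable (n : ℕ) (a : ℝ) (s : ℕ) [NeZero s] (ha : 0 ≤ a) (u w V f : Site d ((n + 1) * s) → ℝ)
  (K : Site d ((n + 1) * s) → Site d ((n + 1) * s) → ℝ) {τ β lam r : ℝ} (hτ : τ ≤ 1)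
  (hwb : ∀ x μ, |w (x + siteOf d ((n + 1) * s) (e μ)) - w x| ≤ τ)
  (hwB : ∀ (y : Site d s) (z z' : Fin d → Fin (n + 1)),
    |w (siteOf d ((n + 1) * s) (chart n (windowMap d s y) z)) - w (siteOf d ((n + 1) * s) (chart n (windowMap d s y) z'))| ≤ β)
  (hV : ∀ x, -lam ≤ V x) (hr : 0 ≤ r)
  (hm : r < min 2 a - lam - 2 * d * (((n : ℝ) + 1) * τ) ^ 2 - a * (exp β - 1))
  (hrow : ∀ x, ∑ z, |K x z| * exp (w x - w z) ≤ r) (hcol : ∀ z, ∑ x, |K x z| * exp (w x - w z) ≤ r)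
  (hu : ∀ x, ((n : ℝ) + 1) ^ 2 * ∑ μ, (2 * u x - u (x + siteOf d ((n + 1) * s) (e μ)) - u (x - siteOf d ((n + 1) * s) (e μ)))
      + a / ((n : ℝ) + 1) ^ d * ∑ q ∈ B n (blk n (windowMap d ((n + 1) * s) x)), u (siteOf d ((n + 1) * s) q)
      + V x * u x + ∑ z, K x z * u z = f x)

include ha hτ hwb hwB hV hr hm hrow hcol hu in
/-- **KERNEL PERTURBATIONS KEEP THE WEIGHTED RESOLVENT LETTER**: `(H + K)u = f`, `K` with conjugated row and column sums `≤ r < m_w` ⟹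
`‖e^{w}u‖₂ ≤ (m_w − r)⁻¹‖e^{w}f‖₂` (§1 ⊛ §2). [folklore] -/
theorem perturbed_kernel_resolvent_le :
    √(∑ x, (exp (w x) * u x) ^ 2)
      ≤ (min 2 a - lam - 2 * d * (((n : ℝ) + 1) * τ) ^ 2 - a * (exp β - 1) - r)⁻¹ * √(∑ x, (exp (w x) * f x) ^ 2) :=
  perturbed_weighted_resolvent_le n a s ha u w V f (fun x => ∑ z, K x z * u z) hτ hwb hwB hV hr hm
    (schur_test_weighted K w u hr hrow hcol) hu

end Kernel

/-- **`H + K` IS INJECTIVE** when `V ≥ −λ`, `a ≥ 0` and the kernel's plain row and column sums are `≤ r < min(2,a) − λ` (the zero weight): two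
fields with the same `(H + K)`-image coincide ((133) `action_sub` for the local part, linearity of the kernel sum, §3 with `w = 0`). [folklore] -/
theorem perturbed_injective (n : ℕ) (a : ℝ) (s : ℕ) [NeZero s] (ha : 0 ≤ a) {lam r : ℝ} (hr : 0 ≤ r) (hm : r < min 2 a - lam)
    (V : Site d ((n + 1) * s) → ℝ) (hV : ∀ x, -lam ≤ V x) (K : Site d ((n + 1) * s) → Site d ((n + 1) * s) → ℝ)
    (hrow : ∀ x, ∑ z, |K x z| ≤ r) (hcol : ∀ z, ∑ x, |K x z| ≤ r) (u u' : Site d ((n + 1) * s) → ℝ)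
    (h : ∀ x, ((n : ℝ) + 1) ^ 2 * ∑ μ, (2 * u x - u (x + siteOf d ((n + 1) * s) (e μ)) - u (x - siteOf d ((n + 1) * s) (e μ)))
        + a / ((n : ℝ) + 1) ^ d * ∑ q ∈ B n (blk n (windowMap d ((n + 1) * s) x)), u (siteOf d ((n + 1) * s) q) + V x * u x
        + ∑ z, K x z * u z
      = ((n : ℝ) + 1) ^ 2 * ∑ μ, (2 * u' x - u' (x + siteOf d ((n + 1) * s) (e μ)) - u' (x - siteOf d ((n + 1) * s) (e μ)))
        + a / ((n : ℝ) + 1) ^ d * ∑ q ∈ B n (blk n (windowMap d ((n + 1) * s) x)), u' (siteOf d ((n + 1) * s) q) + V x * u' x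
        + ∑ z, K x z * u' z) :
    u = u' := by
  set v : Site d ((n + 1) * s) → ℝ := fun x => u x - u' x with hv
  have hK : ∀ x, ∑ z, K x z * v z = ∑ z, K x z * u z - ∑ z, K x z * u' z := fun x => by
    simp only [hv, mul_sub, Finset.sum_sub_distrib]
  have hHv : ∀ x, ((n : ℝ) + 1) ^ 2 * ∑ μ, (2 * v x - v (x + siteOf d ((n + 1) * s) (e μ)) - v (x - siteOf d ((n + 1) * s) (e μ)))
      + a / ((n : ℝ) + 1) ^ d * ∑ q ∈ B n (blk n (windowMap d ((n + 1) * s) x)), v (siteOf d ((n + 1) * s) q) + V x * v x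
      + ∑ z, K x z * v z = (fun _ => (0 : ℝ)) x := by
    intro x
    show _ = (0 : ℝ)
    have hK' := hK x
    simp only [hv] at hK' ⊢
    rw [action_sub n a s V u u' x, hK']
    have hx := h x
    linarith
  have hm' : r < min 2 a - lam - 2 * d * (((n : ℝ) + 1) * 0) ^ 2 - a * (exp 0 - 1) := by simpa using hm
  have hres := perturbed_kernel_resolvent_le n a s ha v (fun _ => 0) V (fun _ => 0) K (τ := 0) (β := 0) (lam := lam) zero_le_one
    (fun _ _ => by simp) (fun _ _ _ => by simp) hV hr hm' (fun x => by simpa using hrow x) (fun z => by simpa using hcol z) hHv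
  simp only [Real.exp_zero, one_mul, mul_zero, ne_eq, OfNat.ofNat_ne_zero, not_false_eq_true, zero_pow, Finset.sum_const_zero,
    Real.sqrt_zero] at hres
  have hzero : ∑ x, v x ^ 2 = 0 := by
    have h0 : 0 ≤ ∑ x, v x ^ 2 := Finset.sum_nonneg fun _ _ => sq_nonneg _
    have h1 : √(∑ x, v x ^ 2) = 0 := le_antisymm hres (Real.sqrt_nonneg _)
    rwa [Real.sqrt_eq_zero h0] at h1
  funext x
  have hx : v x ^ 2 = 0 := (Finset.sum_eq_zero_iff_of_nonneg fun _ _ => sq_nonneg _).1 hzero x (Finset.mem_univ x)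
  have : v x = 0 := pow_eq_zero_iff (n := 2) (by norm_num) |>.1 hx
  simpa [hv, sub_eq_zero] using this

/-! ## §4. Toy -/

/-- Toy: the Schur test with the zero kernel on `Fin 1`. -/
example : √(∑ x : Fin 1, (exp ((fun _ => (0 : ℝ)) x) * ∑ z : Fin 1, (fun _ _ => (0 : ℝ)) x z * (fun _ => (1 : ℝ)) z) ^ 2)
    ≤ 0 * √(∑ z : Fin 1, (exp ((fun _ => (0 : ℝ)) z) * (fun _ => (1 : ℝ)) z) ^ 2) :=
  schur_test_weighted (fun _ _ => (0 : ℝ)) (fun _ => 0) (fun _ => 1) le_rfl (fun _ => by simp) (fun _ => by simp)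

end Summit.QuantumFields.BalabanUV.T4Continuum.NE7b.SupTorusPerturbedResolvent
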